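import Summits.HubbardSuperconductivity.HubbardSuperconductivity.Theses.LiebTwin
import Summits.HubbardSuperconductivity.HubbardSuperconductivity.Theorems.LiebTwinTwinOnsiteCondensationRectificationMonotone
import HarnessLib

/-!
# Route `LiebTwin`, support `OnsiteRectificationMonotone` (item `stmt-HubbardSuperconductivity-15660`)

Closes `Summit.HubbardSuperconductivity.HubbardSuperconductivity.Theses.LiebTwin.OnsiteRectificationMonotone`:
for every real `φ` in the `(n, n)` sector of the fermionic torus `(ℤ/Lℤ)²` whose Lieb matrix `W = liebW n φ`
is symmetric, the twin `φ̃ = liebVec n |W|` (`|W| = CFC.abs W`) carries at least as much on-site `s`-wave pair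
order: `Re⟨φ, Δ_sᴴ Δ_s φ⟩ ≤ Re⟨φ̃, Δ_sᴴ Δ_s φ̃⟩`, `Δ_s = pairField sWave L`.

The mathematics is already in the tree: `LiebTwinTwin.re_expect_pairField_sWave_le_twin_of_real`
(file `Theorems/LiebTwinTwinOnsiteCondensationRectificationMonotone.lean`, landed as a helper of the crux
`TwinOnsiteCondensation`) has exactly the shape of the route statement — Lieb's trace inequality
`Re Tr(W B W Bᴴ) ≤ Re Tr(|W| B |W| Bᴴ)` termwise in the Lieb transfer of the pair field. This file only
records that the support item is thereby settled. Source: E. H. Lieb, PRL **62** (1989) 1201, proof of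
Theorem 1. No definition and no named fact is introduced.
-/

-- the mandated namespace `Summit.<Summit>.<Problem>.Theorems` repeats `HubbardSuperconductivity`
-- (single-problem summit, D-0017), which the `dupNamespace` linter flags on every declaration
set_option linter.dupNamespace false

namespace Summit.HubbardSuperconductivity.HubbardSuperconductivity.Theorems

/-- **On-site rectification monotonicity** (route `LiebTwin`, support `OnsiteRectificationMonotone`, item
`stmt-HubbardSuperconductivity-15660`): for every real `(n, n)`-sector vector `φ` of the torus with symmetric
Lieb matrix, `F_s(φ) ≤ F_s(φ̃)` where `φ̃ = liebVec n (CFC.abs (liebW n φ))` and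
`F_s(χ) = Re⟨χ, (pairField sWave L)ᴴ (pairField sWave L) χ⟩` — on-site pair order can only grow under
rectification (inequality half of identity (I3) of the route card). Lieb, PRL 62 (1989) 1201, proof of
Theorem 1. [cite: LiebPRL1989, proof of Theorem 1] -/
theorem onsiteRectificationMonotone_proof :
    Summit.HubbardSuperconductivity.HubbardSuperconductivity.Theses.LiebTwin.OnsiteRectificationMonotone := by
  intro L _ n φ hreal hφ hsymm
  exact LiebTwinTwin.re_expect_pairField_sWave_le_twin_of_real L n φ hreal hφ hsymm

end Summit.HubbardSuperconductivity.HubbardSuperconductivity.Theorems
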